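import Literature.Geometry.Riemannian.PinchingEstimatesODE
import Literature.Geometry.Riemannian.PinchingSetsConcavity
import HarnessLib

/-!
# Hamilton's pinching sets are closed, convex and reflection-symmetric
(topic `Geometry/Riemannian`)

Structural facts about the variational pinching sets of `PinchingEstimatesODE.lean`, needed to
feed them to the maximum principle `hamilton_maximumPrinciple_curvatureODE`
(`HamiltonCurvatureODE.lean`) in the assembly of
`Literature.Geometry.Riemannian.hamilton_chenZhu_pinching` (`PinchingEstimatesAssembly.lean`):

* **closedness** — each set is an intersection, over unit vectors, of non-strict inequalities
  between continuous functions of `(A, B, C)` (and of `t`, for the time-dependent sets of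
  Thms. 1.9 / 2.3, whose space-time track is closed); the only delicate point is the factor
  `max{ln √x, Q}`, which is continuous although `ln` is not (`max{ln √x, Q} = max{ln max{√x, 1}, Q}`
  for `Q ≥ 0`, `continuous_max_log_sqrt`);
* **convexity** in chord form (Hamilton 1997, p. 8, pp. 13–14, p. 17), on the constraint sets
  where Hamilton uses them (`a₁ + a₂, c₁ + c₂ ≥ m ≥ 0` for Thms. 1.3 / 2.1; `a₁ + ρ, c₁ + ρ ≥ 0`
  for Thms. 1.9 / 2.3), from the chord inequalities of `PinchingSetsConcavity.lean`;
* **symmetry under `B ↦ -B`** (`HamiltonODE.reflectB`), the sets depending on `B` only through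
  maxima of `uᵀBv` over unit vectors.

## References

* R. S. Hamilton, *Four-manifolds with positive isotropic curvature*, Comm. Anal. Geom. 5 (1997)
  1–92, §2.1 (p. 8, p. 11) and §2.2 (pp. 13–14, p. 17): convexity of the pinching sets. [Hamilton1997]
-/

noncomputable section

open Set Real
open scoped Matrix Topology

namespace Literature.Geometry.Riemannian

namespace HamiltonODE

/-! ### Small tools -/

section Tools

variable {α : Type*} [TopologicalSpace α]

/-- A set cut out by a family of closed conditions is closed (also over `Prop`-valued indices,
i.e. hypotheses such as `u ⬝ᵥ u = 1 → …`). [folklore] -/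
theorem isClosed_setOf_forall' {ι : Sort*} {P : ι → α → Prop} (h : ∀ i, IsClosed {a | P i a}) :
    IsClosed {a | ∀ i, P i a} := by
  rw [Set.setOf_forall]; exact isClosed_iInter h

/-- `max{ln √x, Q} = max{ln (max{√x, 1}), Q}` for `Q ≥ 0` (for `√x < 1` both sides are `Q`).
[folklore] -/
theorem max_log_sqrt_eq {Q : ℝ} (hQ : 0 ≤ Q) (x : ℝ) :
    max (log (sqrt x)) Q = max (log (max (sqrt x) 1)) Q := by
  rcases le_or_gt 1 (sqrt x) with h | h
  · rw [max_eq_left h]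
  · rw [max_eq_right h.le, log_one, max_eq_right hQ, max_eq_right]
    exact (Real.log_nonpos (sqrt_nonneg x) h.le).trans hQ

/-- `a ↦ max{ln √(f a), Q}` is continuous for continuous `f` and `Q ≥ 0`, although `ln` is not
continuous at `0`. [folklore] -/
theorem continuous_max_log_sqrt {Q : ℝ} (hQ : 0 ≤ Q) {f : α → ℝ} (hf : Continuous f) :
    Continuous fun a ↦ max (log (sqrt (f a))) Q := by
  have e : (fun a ↦ max (log (sqrt (f a))) Q) = fun a ↦ max (log (max (sqrt (f a)) 1)) Q :=
    funext fun a ↦ max_log_sqrt_eq hQ (f a)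
  rw [e]
  refine Continuous.max (Continuous.log (hf.sqrt.max continuous_const) fun a ↦ ?_) continuous_const
  exact (lt_of_lt_of_le one_pos (le_max_right _ _)).ne'

/-- Continuity of Hamilton's right-hand side `(1 + c / max{ln √x, Q}) √x` in `(c, x)` along
continuous `c, x`. [folklore] -/
theorem continuous_logBarrier {Q : ℝ} (hQ : 0 < Q) {c f : α → ℝ} (hc : Continuous c)
    (hf : Continuous f) :
    Continuous fun a ↦ (1 + c a / max (log (sqrt (f a))) Q) * sqrt (f a) :=
  ((continuous_const.add (hc.div (continuous_max_log_sqrt hQ.le hf)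
    fun _ ↦ (lt_max_of_lt_right hQ).ne')).mul hf.sqrt)

variable (u v : Fin 3 → ℝ)

/-- `p ↦ uᵀ A v` is continuous on block triples. [folklore] -/
theorem continuous_quadA : Continuous fun p : Blocks ↦ u ⬝ᵥ (p.1 *ᵥ v) :=
  Continuous.dotProduct continuous_const (continuous_fst.matrix_mulVec continuous_const)

/-- `p ↦ uᵀ B v` is continuous. [folklore] -/
theorem continuous_quadB : Continuous fun p : Blocks ↦ u ⬝ᵥ (p.2.1 *ᵥ v) :=
  Continuous.dotProduct continuous_const (continuous_snd.fst.matrix_mulVec continuous_const)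

/-- `p ↦ uᵀ C v` is continuous. [folklore] -/
theorem continuous_quadC : Continuous fun p : Blocks ↦ u ⬝ᵥ (p.2.2 *ᵥ v) :=
  Continuous.dotProduct continuous_const (continuous_snd.snd.matrix_mulVec continuous_const)

/-- Quadratic forms are linear in the matrix: `uᵀ(aA + bA')v = a uᵀAv + b uᵀA'v`. [folklore] -/
theorem quad_combo (A A' : Matrix (Fin 3) (Fin 3) ℝ) (a b : ℝ) :
    u ⬝ᵥ ((a • A + b • A') *ᵥ v) = a * (u ⬝ᵥ (A *ᵥ v)) + b * (u ⬝ᵥ (A' *ᵥ v)) := by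
  simp [Matrix.add_mulVec, Matrix.smul_mulVec, dotProduct_add, dotProduct_smul]

/-- First component of the reflection. [folklore] -/
@[simp] theorem reflectB_fst (p : Blocks) : (reflectB p).1 = p.1 := rfl
/-- Second component of the reflection. [folklore] -/
@[simp] theorem reflectB_snd_fst (p : Blocks) : (reflectB p).2.1 = -p.2.1 := rfl
/-- Third component of the reflection. [folklore] -/
@[simp] theorem reflectB_snd_snd (p : Blocks) : (reflectB p).2.2 = p.2.2 := rfl

/-- `uᵀ(-B)v = uᵀB(-v)`: reflecting `B` is absorbed by reflecting the second unit vector.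
[folklore] -/
theorem quad_negB (B : Matrix (Fin 3) (Fin 3) ℝ) :
    u ⬝ᵥ ((-B) *ᵥ v) = u ⬝ᵥ (B *ᵥ (-v)) := by
  rw [Matrix.neg_mulVec, Matrix.mulVec_neg]

end Tools

/-! ### Symmetry under `B ↦ -B` -/

section Reflect

variable {p : Blocks}

/-- Thm. 1.3's set is symmetric under `B ↦ -B`. [folklore] -/
theorem SingularValuesSumSqLE.reflectB {Λ : ℝ} (h : SingularValuesSumSqLE p Λ) :
    SingularValuesSumSqLE (reflectB p) Λ := by
  intro u₁ u₂ v₁ v₂ w w' z z' hu₁ hu₂ hu hv₁ hv₂ hv hw hw' hww hz hz' hzz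
  simp only [reflectB_fst, reflectB_snd_fst, reflectB_snd_snd, quad_negB]
  exact h u₁ u₂ (-v₁) (-v₂) w w' z z' hu₁ hu₂ hu (by simpa using hv₁) (by simpa using hv₂)
    (by simp [hv]) hw hw' hww hz hz' hzz

/-- Thm. 1.9's set is symmetric under `B ↦ -B`. [folklore] -/
theorem SingularValueLEExp.reflectB {H P ρ t : ℝ} (h : SingularValueLEExp p H P ρ t) :
    SingularValueLEExp (reflectB p) H P ρ t := by
  intro u v w z hu hv hw hz
  simp only [reflectB_fst, reflectB_snd_fst, reflectB_snd_snd, quad_negB]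
  exact h u (-v) w z hu (by simpa using hv) hw hz

/-- Thm. 2.1's set is symmetric under `B ↦ -B`. [folklore] -/
theorem ImprovedPinching.reflectB {K : ℝ} (h : ImprovedPinching p K) :
    ImprovedPinching (reflectB p) K := by
  intro u v w w' z z' hu hv hw hw' hww hz hz' hzz
  simp only [reflectB_fst, reflectB_snd_fst, reflectB_snd_snd, quad_negB]
  exact h u (-v) w w' z z' hu (by simpa using hv) hw hw' hww hz hz' hzz

/-- Thm. 2.3's set is symmetric under `B ↦ -B`. [folklore] -/
theorem ImprovedPinchingQ.reflectB {ρ L P Q t : ℝ} (h : ImprovedPinchingQ p ρ L P Q t) :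
    ImprovedPinchingQ (reflectB p) ρ L P Q t := by
  intro u v w w' hu hv hw hw'
  simp only [reflectB_fst, reflectB_snd_fst, reflectB_snd_snd, quad_negB]
  exact h u (-v) w w' hu (by simpa using hv) hw hw'

end Reflect

/-! ### Closedness (and closed space-time tracks) -/

section Closed

/-- `{A | a₁ + a₂ ≥ m}` is closed, as a condition on block triples through `A` … [folklore] -/
theorem isClosed_twoSmallestA (m : ℝ) :
    IsClosed {p : Blocks | p.1.TwoSmallestEigenvaluesSumGE m} := by
  iterate 5 refine isClosed_setOf_forall' fun _ ↦ ?_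
  exact isClosed_le continuous_const ((continuous_quadA _ _).add (continuous_quadA _ _))

/-- … and through `C`. [folklore] -/
theorem isClosed_twoSmallestC (m : ℝ) :
    IsClosed {p : Blocks | p.2.2.TwoSmallestEigenvaluesSumGE m} := by
  iterate 5 refine isClosed_setOf_forall' fun _ ↦ ?_
  exact isClosed_le continuous_const ((continuous_quadC _ _).add (continuous_quadC _ _))

/-- Thm. 1.3's set is closed. [folklore] -/
theorem isClosed_singularValuesSumSqLE (Λ : ℝ) :
    IsClosed {p : Blocks | SingularValuesSumSqLE p Λ} := by
  iterate 20 refine isClosed_setOf_forall' fun _ ↦ ?_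
  exact isClosed_le (((continuous_quadB _ _).add (continuous_quadB _ _)).pow 2)
    (((continuous_const.mul ((continuous_quadA _ _).add (continuous_quadA _ _))).mul
      ((continuous_quadC _ _).add (continuous_quadC _ _))))

/-- The Bianchi constraint `tr A = tr C` is closed. [folklore] -/
theorem isClosed_trace_eq : IsClosed {p : Blocks | p.1.trace = p.2.2.trace} :=
  isClosed_eq continuous_fst.matrix_trace continuous_snd.snd.matrix_trace

/-- Thm. 1.4's sets are closed (through `A` …). [folklore] -/
theorem isClosed_twoLargestA (Φ : ℝ) :
    IsClosed {p : Blocks | p.1.TwoLargestEigenvaluesSumLE Φ} := by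
  iterate 10 refine isClosed_setOf_forall' fun _ ↦ ?_
  exact isClosed_le ((continuous_quadA _ _).add (continuous_quadA _ _))
    (continuous_const.mul ((continuous_quadA _ _).add (continuous_quadA _ _)))

/-- … and through `C`. [folklore] -/
theorem isClosed_twoLargestC (Φ : ℝ) :
    IsClosed {p : Blocks | p.2.2.TwoLargestEigenvaluesSumLE Φ} := by
  iterate 10 refine isClosed_setOf_forall' fun _ ↦ ?_
  exact isClosed_le ((continuous_quadC _ _).add (continuous_quadC _ _))
    (continuous_const.mul ((continuous_quadC _ _).add (continuous_quadC _ _)))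

/-- Thm. 1.6's sets are closed. [folklore] -/
theorem isClosed_smallestAddNonnegA (ρ : ℝ) :
    IsClosed {p : Blocks | p.1.SmallestEigenvalueAddNonneg ρ} := by
  iterate 2 refine isClosed_setOf_forall' fun _ ↦ ?_
  exact isClosed_le continuous_const ((continuous_quadA _ _).add continuous_const)

/-- Thm. 1.6's set through `C` is closed. [folklore] -/
theorem isClosed_smallestAddNonnegC (ρ : ℝ) :
    IsClosed {p : Blocks | p.2.2.SmallestEigenvalueAddNonneg ρ} := by
  iterate 2 refine isClosed_setOf_forall' fun _ ↦ ?_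
  exact isClosed_le continuous_const ((continuous_quadC _ _).add continuous_const)

/-- Thm. 1.7's sets are closed. [folklore] -/
theorem isClosed_largestLESmallestAddA (Ψ ρ : ℝ) :
    IsClosed {p : Blocks | p.1.LargestLESmallestAdd Ψ ρ} := by
  iterate 4 refine isClosed_setOf_forall' fun _ ↦ ?_
  exact isClosed_le (continuous_quadA _ _)
    (continuous_const.mul ((continuous_quadA _ _).add continuous_const))

/-- Thm. 1.7's set through `C` is closed. [folklore] -/
theorem isClosed_largestLESmallestAddC (Ψ ρ : ℝ) :
    IsClosed {p : Blocks | p.2.2.LargestLESmallestAdd Ψ ρ} := by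
  iterate 4 refine isClosed_setOf_forall' fun _ ↦ ?_
  exact isClosed_le (continuous_quadC _ _)
    (continuous_const.mul ((continuous_quadC _ _).add continuous_const))

/-- The space-time track of Thm. 1.9's family is closed (jointly in `(t, (A, B, C))`). [folklore] -/
theorem isClosed_singularValueLEExp_track (H P ρ : ℝ) :
    IsClosed {q : ℝ × Blocks | SingularValueLEExp q.2 H P ρ q.1} := by
  iterate 8 refine isClosed_setOf_forall' fun _ ↦ ?_
  refine isClosed_le ((continuous_quadB _ _).comp continuous_snd) ?_
  exact ((continuous_const.mul (continuous_const.mul continuous_fst).rexp).mul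
    ((((continuous_quadA _ _).comp continuous_snd).add continuous_const).mul
      (((continuous_quadC _ _).comp continuous_snd).add continuous_const)).sqrt)

/-- Thm. 1.9's set at a fixed time is closed. [folklore] -/
theorem isClosed_singularValueLEExp (H P ρ t : ℝ) :
    IsClosed {p : Blocks | SingularValueLEExp p H P ρ t} :=
  (isClosed_singularValueLEExp_track H P ρ).preimage (Continuous.prodMk_right t)

/-- Thm. 2.1's set is closed (`max{ln √x, 2}` is continuous). [folklore] -/
theorem isClosed_improvedPinching (K : ℝ) : IsClosed {p : Blocks | ImprovedPinching p K} := by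
  iterate 14 refine isClosed_setOf_forall' fun _ ↦ ?_
  refine isClosed_le (continuous_const.mul (continuous_quadB _ _)) ?_
  exact continuous_logBarrier two_pos continuous_const
    (((continuous_quadA _ _).add (continuous_quadA _ _)).mul
      ((continuous_quadC _ _).add (continuous_quadC _ _)))

/-- The space-time track of Thm. 2.3's family is closed, for `Q > 0`. [folklore] -/
theorem isClosed_improvedPinchingQ_track {Q : ℝ} (hQ : 0 < Q) (ρ L P : ℝ) :
    IsClosed {q : ℝ × Blocks | ImprovedPinchingQ q.2 ρ L P Q q.1} := by
  iterate 8 refine isClosed_setOf_forall' fun _ ↦ ?_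
  refine isClosed_le ((continuous_quadB _ _).comp continuous_snd) ?_
  exact continuous_logBarrier hQ (continuous_const.mul (continuous_const.mul continuous_fst).rexp)
    ((((continuous_quadA _ _).comp continuous_snd).add continuous_const).mul
      (((continuous_quadC _ _).comp continuous_snd).add continuous_const))

/-- Thm. 2.3's set at a fixed time is closed, for `Q > 0`. [folklore] -/
theorem isClosed_improvedPinchingQ {Q : ℝ} (hQ : 0 < Q) (ρ L P t : ℝ) :
    IsClosed {p : Blocks | ImprovedPinchingQ p ρ L P Q t} :=
  (isClosed_improvedPinchingQ_track hQ ρ L P).preimage (Continuous.prodMk_right t)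

end Closed

/-! ### Convexity (chord form) -/

section Convex

variable {x y : Blocks} {a b : ℝ}

/-- First component of a linear combination of block triples. [folklore] -/
@[simp] theorem combo_fst (x y : Blocks) (a b : ℝ) : (a • x + b • y).1 = a • x.1 + b • y.1 := rfl
/-- Second component of a linear combination of block triples. [folklore] -/
@[simp] theorem combo_snd_fst (x y : Blocks) (a b : ℝ) :
    (a • x + b • y).2.1 = a • x.2.1 + b • y.2.1 := rfl
/-- Third component of a linear combination of block triples. [folklore] -/
@[simp] theorem combo_snd_snd (x y : Blocks) (a b : ℝ) :
    (a • x + b • y).2.2 = a • x.2.2 + b • y.2.2 := rfl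

/-- Sums of two quadratic forms are linear in the matrix. [folklore] -/
theorem two_quad_combo (X Y : Matrix (Fin 3) (Fin 3) ℝ) (u₁ v₁ u₂ v₂ : Fin 3 → ℝ) (a b : ℝ) :
    u₁ ⬝ᵥ ((a • X + b • Y) *ᵥ v₁) + u₂ ⬝ᵥ ((a • X + b • Y) *ᵥ v₂) =
      a * (u₁ ⬝ᵥ (X *ᵥ v₁) + u₂ ⬝ᵥ (X *ᵥ v₂)) + b * (u₁ ⬝ᵥ (Y *ᵥ v₁) + u₂ ⬝ᵥ (Y *ᵥ v₂)) := by
  rw [quad_combo, quad_combo]; ring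

/-- `wᵀ(aX + bY)w + ρ = a(wᵀXw + ρ) + b(wᵀYw + ρ)` when `a + b = 1`. [folklore] -/
theorem quad_add_const_combo (X Y : Matrix (Fin 3) (Fin 3) ℝ) (w : Fin 3 → ℝ) (ρ : ℝ)
    (hab : a + b = 1) :
    w ⬝ᵥ ((a • X + b • Y) *ᵥ w) + ρ = a * (w ⬝ᵥ (X *ᵥ w) + ρ) + b * (w ⬝ᵥ (Y *ᵥ w) + ρ) := by
  rw [quad_combo]; linear_combination (-ρ) * hab

/-- `{a₁ + a₂ ≥ m}` is convex (Hamilton 1997, p. 7: "`a₁ + a₂` is a concave function of `A`").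
[cite: Hamilton1997, §2.1, Thm. 1.2 (proof, p. 7)] -/
theorem _root_.Matrix.TwoSmallestEigenvaluesSumGE.combo {X Y : Matrix (Fin 3) (Fin 3) ℝ} {m : ℝ}
    (hx : X.TwoSmallestEigenvaluesSumGE m) (hy : Y.TwoSmallestEigenvaluesSumGE m) (ha : 0 ≤ a)
    (hb : 0 ≤ b) (hab : a + b = 1) : (a • X + b • Y).TwoSmallestEigenvaluesSumGE m := by
  intro u v hu hv huv
  rw [two_quad_combo]
  have hm : m = a * m + b * m := by rw [← add_mul, hab, one_mul]
  nlinarith [mul_le_mul_of_nonneg_left (hx u v hu hv huv) ha,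
    mul_le_mul_of_nonneg_left (hy u v hu hv huv) hb]

/-- `{a₂ + a₃ ≤ Φ(a₁ + a₂)}` is convex ("`a₂ + a₃` convex, `a₁ + a₂` concave", Hamilton 1997,
p. 9). [cite: Hamilton1997, §2.1, Thm. 1.4 (p. 8)] -/
theorem _root_.Matrix.TwoLargestEigenvaluesSumLE.combo {X Y : Matrix (Fin 3) (Fin 3) ℝ} {Φ : ℝ}
    (hx : X.TwoLargestEigenvaluesSumLE Φ) (hy : Y.TwoLargestEigenvaluesSumLE Φ) (ha : 0 ≤ a)
    (hb : 0 ≤ b) : (a • X + b • Y).TwoLargestEigenvaluesSumLE Φ := by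
  intro u v w w' hu hv huv hw hw' hww'
  rw [two_quad_combo, two_quad_combo]
  nlinarith [mul_le_mul_of_nonneg_left (hx u v w w' hu hv huv hw hw' hww') ha,
    mul_le_mul_of_nonneg_left (hy u v w w' hu hv huv hw hw' hww') hb]

/-- `{a₁ + ρ ≥ 0}` is convex (`a₁` concave). [cite: Hamilton1997, §2.1, Thm. 1.6 (p. 10)] -/
theorem _root_.Matrix.SmallestEigenvalueAddNonneg.combo {X Y : Matrix (Fin 3) (Fin 3) ℝ} {ρ : ℝ}
    (hx : X.SmallestEigenvalueAddNonneg ρ) (hy : Y.SmallestEigenvalueAddNonneg ρ) (ha : 0 ≤ a)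
    (hb : 0 ≤ b) (hab : a + b = 1) : (a • X + b • Y).SmallestEigenvalueAddNonneg ρ := by
  intro w hw
  rw [quad_add_const_combo X Y w ρ hab]
  exact add_nonneg (mul_nonneg ha (hx w hw)) (mul_nonneg hb (hy w hw))

/-- `{a₃ ≤ Ψ(a₁ + ρ)}` is convex ("`a₃` is convex and `a₁ + ρ` is concave", Hamilton 1997,
p. 11). [cite: Hamilton1997, §2.1, Thm. 1.7 (proof, p. 11)] -/
theorem _root_.Matrix.LargestLESmallestAdd.combo {X Y : Matrix (Fin 3) (Fin 3) ℝ} {Ψ ρ : ℝ}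
    (hx : X.LargestLESmallestAdd Ψ ρ) (hy : Y.LargestLESmallestAdd Ψ ρ) (ha : 0 ≤ a)
    (hb : 0 ≤ b) (hab : a + b = 1) : (a • X + b • Y).LargestLESmallestAdd Ψ ρ := by
  intro u w hu hw
  rw [quad_combo, quad_add_const_combo X Y w ρ hab, mul_add, ← mul_assoc, ← mul_assoc,
    mul_comm Ψ a, mul_comm Ψ b, mul_assoc, mul_assoc]
  exact add_le_add (mul_le_mul_of_nonneg_left (hx u w hu hw) ha)
    (mul_le_mul_of_nonneg_left (hy u w hu hw) hb)

/-- The Bianchi constraint `tr A = tr C` is convex (linear). [folklore] -/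
theorem trace_eq_combo (hx : x.1.trace = x.2.2.trace) (hy : y.1.trace = y.2.2.trace) (a b : ℝ) :
    (a • x + b • y).1.trace = (a • x + b • y).2.2.trace := by
  simp [Matrix.trace_add, Matrix.trace_smul, hx, hy]

/-- **Thm. 1.3's set is convex on `{a₁ + a₂ ≥ m, c₁ + c₂ ≥ m}`, `m ≥ 0`** (Hamilton 1997, p. 8:
"`a₁ + a₂` and `c₁ + c₂` are concave functions, while `b₂ + b₃` is convex. Moreover the set
`y² ≤ Λxz` is convex for any `Λ`. Therefore the inequality defines a convex set of matrices"),
chord form. [cite: Hamilton1997, §2.1, Thm. 1.3 (proof, p. 8)] -/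
theorem SingularValuesSumSqLE.combo {m Λ : ℝ} (hm : 0 ≤ m) (hΛ : 0 ≤ Λ)
    (hxA : x.1.TwoSmallestEigenvaluesSumGE m) (hxC : x.2.2.TwoSmallestEigenvaluesSumGE m)
    (hyA : y.1.TwoSmallestEigenvaluesSumGE m) (hyC : y.2.2.TwoSmallestEigenvaluesSumGE m)
    (hx : SingularValuesSumSqLE x Λ) (hy : SingularValuesSumSqLE y Λ) (ha : 0 ≤ a) (hb : 0 ≤ b) :
    SingularValuesSumSqLE (a • x + b • y) Λ := by
  intro u₁ u₂ v₁ v₂ w w' z z' hu₁ hu₂ hu hv₁ hv₂ hv hw hw' hww hz hz' hzz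
  simp only [combo_fst, combo_snd_fst, combo_snd_snd]
  rw [two_quad_combo, two_quad_combo, two_quad_combo]
  exact sq_combo_le ha hb hΛ (hm.trans (hxA w w' hw hw' hww)) (hm.trans (hyA w w' hw hw' hww))
    (hm.trans (hxC z z' hz hz' hzz)) (hm.trans (hyC z z' hz hz' hzz))
    (hx u₁ u₂ v₁ v₂ w w' z z' hu₁ hu₂ hu hv₁ hv₂ hv hw hw' hww hz hz' hzz)
    (hy u₁ u₂ v₁ v₂ w w' z z' hu₁ hu₂ hu hv₁ hv₂ hv hw hw' hww hz hz' hzz)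

/-- **Thm. 1.9's set at time `t` is convex on `{a₁ + ρ ≥ 0, c₁ + ρ ≥ 0}`** for `H ≥ 0` (`b₃`
convex, `√((a₁+ρ)(c₁+ρ))` concave; Hamilton 1997, p. 13: "since `y² ≤ Cxz` is a convex set,
this proves the Theorem"), chord form. [cite: Hamilton1997, §2.1, Thm. 1.9 (proof, p. 13)] -/
theorem SingularValueLEExp.combo {H P ρ t : ℝ} (hH : 0 ≤ H)
    (hxA : x.1.SmallestEigenvalueAddNonneg ρ) (hxC : x.2.2.SmallestEigenvalueAddNonneg ρ)
    (hyA : y.1.SmallestEigenvalueAddNonneg ρ) (hyC : y.2.2.SmallestEigenvalueAddNonneg ρ)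
    (hx : SingularValueLEExp x H P ρ t) (hy : SingularValueLEExp y H P ρ t) (ha : 0 ≤ a)
    (hb : 0 ≤ b) (hab : a + b = 1) : SingularValueLEExp (a • x + b • y) H P ρ t := by
  intro u v w z hu hv hw hz
  simp only [combo_fst, combo_snd_fst, combo_snd_snd]
  rw [quad_combo, quad_add_const_combo _ _ w ρ hab, quad_add_const_combo _ _ z ρ hab]
  exact sqrt_combo_le ha hb (mul_nonneg hH (exp_pos (P * t)).le) (hxA w hw) (hyA w hw)
    (hxC z hz) (hyC z hz) (hx u v w z hu hv hw hz) (hy u v w z hu hv hw hz)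

/-- **Thm. 2.1's set is convex on `{a₁ + a₂ ≥ m, c₁ + c₂ ≥ m}`, `m ≥ 0`, for `K ≥ 0`**
(Hamilton 1997, pp. 13–14), chord form. [cite: Hamilton1997, §2.2, Thm. 2.1 (proof, pp. 13–14)] -/
theorem ImprovedPinching.combo {m K : ℝ} (hm : 0 ≤ m) (hK : 0 ≤ K)
    (hxA : x.1.TwoSmallestEigenvaluesSumGE m) (hxC : x.2.2.TwoSmallestEigenvaluesSumGE m)
    (hyA : y.1.TwoSmallestEigenvaluesSumGE m) (hyC : y.2.2.TwoSmallestEigenvaluesSumGE m)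
    (hx : ImprovedPinching x K) (hy : ImprovedPinching y K) (ha : 0 ≤ a) (hb : 0 ≤ b)
    (hab : a + b = 1) : ImprovedPinching (a • x + b • y) K := by
  intro u v w w' z z' hu hv hw hw' hww hz hz' hzz
  simp only [combo_fst, combo_snd_fst, combo_snd_snd]
  rw [quad_combo, two_quad_combo, two_quad_combo,
    show ∀ p q : ℝ, 2 * (a * p + b * q) = a * (2 * p) + b * (2 * q) from fun p q ↦ by ring]
  exact logBarrier_combo_le hK le_rfl ha hb hab (hm.trans (hxA w w' hw hw' hww))
    (hm.trans (hyA w w' hw hw' hww)) (hm.trans (hxC z z' hz hz' hzz))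
    (hm.trans (hyC z z' hz hz' hzz)) (hx u v w w' z z' hu hv hw hw' hww hz hz' hzz)
    (hy u v w w' z z' hu hv hw hw' hww hz hz' hzz)

/-- **Thm. 2.3's set at time `t` is convex on `{a₁ + ρ ≥ 0, c₁ + ρ ≥ 0}`, for `L ≥ 0`,
`Q ≥ 2`** (Hamilton 1997, p. 17: "The inequality defines a convex set for the same reason as
before if `Q ≥ 2`"), chord form. [cite: Hamilton1997, §2.2, Thm. 2.3 (proof, p. 17)] -/
theorem ImprovedPinchingQ.combo {ρ L P Q t : ℝ} (hL : 0 ≤ L) (hQ : 2 ≤ Q)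
    (hxA : x.1.SmallestEigenvalueAddNonneg ρ) (hxC : x.2.2.SmallestEigenvalueAddNonneg ρ)
    (hyA : y.1.SmallestEigenvalueAddNonneg ρ) (hyC : y.2.2.SmallestEigenvalueAddNonneg ρ)
    (hx : ImprovedPinchingQ x ρ L P Q t) (hy : ImprovedPinchingQ y ρ L P Q t) (ha : 0 ≤ a)
    (hb : 0 ≤ b) (hab : a + b = 1) : ImprovedPinchingQ (a • x + b • y) ρ L P Q t := by
  intro u v w w' hu hv hw hw'
  simp only [combo_fst, combo_snd_fst, combo_snd_snd]
  rw [quad_combo, quad_add_const_combo _ _ w ρ hab, quad_add_const_combo _ _ w' ρ hab]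
  exact logBarrier_combo_le (mul_nonneg hL (exp_pos (P * t)).le) hQ ha hb hab (hxA w hw)
    (hyA w hw) (hxC w' hw') (hyC w' hw') (hx u v w w' hu hv hw hw') (hy u v w w' hu hv hw hw')

end Convex

end HamiltonODE

end Literature.Geometry.Riemannian

end
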